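import Summits.BirchSwinnertonDyer.BirchSwinnertonDyer.Theses.QuadraticBranchSignedControl
import Summits.BirchSwinnertonDyer.BirchSwinnertonDyer.Theorems.QuadraticBranchSignedControlThm74OfEtaExactSequences
import Summits.BirchSwinnertonDyer.Rank1Residual.Additive.QuadraticBranchPlusEtaNodes
import Summits.BirchSwinnertonDyer.Rank1Residual.Additive.QuadraticBranchPlusLFunctionUnique
import Summits.BirchSwinnertonDyer.Rank1Residual.Additive.FouquetWanLocus
import Summits.BirchSwinnertonDyer.Rank1Residual.Additive.LocIrrOddPrimes
import Literature.NumberTheory.EllipticCurves.Kobayashi2003.SignedSelmerEtaComponentFacts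
import HarnessLib

/-!
# Route `QuadraticBranchSignedControl` (rung K8, cell `bsd-potss`), child crux `PlusEtaLowerInclusion`
# (item stmt-BirchSwinnertonDyer-19601), registered stub `stub_etaLower_fwLocus`: (E⁺_η) on the
# FOUQUET–WAN SUB-LOCUS from ONE displayed claim-frame — Kato's main conjecture at the `η`-component —
# with the projection to Kobayashi's even side PROVED in the kernel

WHAT. The planner's BC3 skeleton of the child crux 19601 (`Cruxes/PlusEtaLowerInclusion`, copy
`run/shared/lean/pub/bsd-potss/plan/edit-g14/bc/PlusEtaLowerInclusion_birth.lean`, namespace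
`…Cruxes.PlusEtaLowerInclusion.Birth`) cuts the Eisenstein inclusion (E⁺_η)
`QuadraticBranchPlusEtaLowerInclusionAt V p` (`Char(X⁺(V/K_∞)^η) ⊆ (L_p⁺(V, η, X))` VERBATIM on the
`η`-component object, `Additive/QuadraticBranchPlusEtaNodes.lean`) on the `p`-adic-tower-onto Gss2
twists `V`, `p ≥ 5`, by LOCUS: `stub_etaLower_fwLocus` = the twists INSIDE the Fouquet–Wan sub-locus
`FWLocus V p` (a Gss2 partner `W`, `C • W^{(p*)} = V`, `Addv W p ∧ SubGss W p`, with a NON-SPLIT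
multiplicative prime at which `W[p]` is ramified, `FWNonsplitRam W p`, and `SL₂(ℤ_p) ⊆ im ρ_{W,p^∞}`),
`stub_etaLower_offLocus` = the rest. The programme's ACCEL row for this stub (bsd-potss STATUS
2026-08-26 «ACCEL-LIST» (6)) asks for the typing «Fouquet–Wan claim fact → stub» with ONE PRE binder.
THIS FILE:
* §1 `EtaKatoFrame V W C p` is NOT a definition but a DISPLAYED HYPOTHESIS `hK` (spelled out in each
  signature): **Kato's main conjecture for `T_pV` at the component `η = ω^{(p−1)/2}`** (Kobayashi §5
  p. 10: "`Char 𝐇²(T)^η = Char 𝐇¹(T)^η/Z(T)^η`") in the only currency the tree has for Kato's modules —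
  their printed role in the plus `η`-exact sequence of the proof of Kobayashi's Thm. 7.4 (p. 13,
  `0 → 𝐇¹(T)^η/Z(T)^η → Λ^η/(L_p⁺(E, η, X)) → X⁺(E/K_∞)^η → X⁰(E/K_∞)^η → 0`, `X⁰ ≅ 𝐇²` Prop. 7.1 ii),
  torsion Cor. 7.2): modules `A`, `B` (`B` f.g. torsion), SOME `Lp` with the interpolation property of
  `L_p⁺(V, η, X)`, for EVERY dual datum `D` an exact `0 → A → Λ/(Lp) → D.X → B → 0`, AND
  `char(A) = char(B)`. It is, binder for binder, the body of the Literature OPEN binder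
  `FouquetWan2021.thm51_etaKatoMC_OPEN` (proposed with this file; Fouquet–Wan
  arXiv:2107.13726 Thm. 5.1 / Prop. 5.6 for `f_W = f_V ⊗ η` — an UNREFEREED CLAIM — read at the
  `η`-component of `T_pV`, reading flag `FW21-eta-twist-transfer`), specialised to one pair.
* §1 `plusEtaMainConjectureAt_of_etaKatoFrame` — **the `η`-PROJECTION, kernel-checked**: from `hK`
  (for one `V` with ANY partner datum) Kobayashi's even main conjecture at `η` (C1⁺_η)
  `QuadraticBranchPlusEtaMainConjectureAt V p` — finite generation and torsion of `X⁺(V/K_∞)^η` from the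
  sequence (`Module.Finite.of_exact`, `Thm74Skeleton.isTorsion_of_exact`), `Char = (Lp)` from
  `char(A) = char(B)` by `Thm74Skeleton.charIdeal_eq_span_singleton_iff_of_fourTermExact` (k8q-c3 g3,
  p-landed), `Lp ≠ 0` by Rohrlich (`IsQuadraticBranchPlusLFunction.ne_zero_of_isNewformOf`, PROVED) and
  the choice-freeness of `(L_p⁺(V, η, X))` (`….span_singleton_eq`, PROVED); hence (E⁺_η)
  (`plusEtaLowerInclusionAt_of_etaKatoFrame`). This is Kobayashi's sentence "The theorem follows from
  these sequences" for the direction Kato ⟹ even, at `η`, in the kernel.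
* §2 `plusEtaMainConjectureAt_of_etaKatoClaimFrame` / `plusEtaLowerInclusionAt_…`: the same from the
  ∀-frame `hFW` (the binder's body verbatim) on its locus (`Irr W p`, the non-split ramified Steinberg
  prime), and **`stub_etaLower_fwLocus_of_etaKatoClaimFrame` — `Sig.stub_etaLower_fwLocus` VERBATIM**
  (the abbreviation `FWLocus V p` unfolded to its `∃`-datum, as in the parent's stubs file
  `…PlusLowerInclusionStubs.lean`): on Gss2 `Irr W p` is automatic (`irr_of_subGss_of_ne_two`) and
  `FWNonsplitRam W p` IS the `ℓ`-datum; the tower and `SL₂` binders of the stub are not even used.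
* §3 `plusEtaLowerInclusion_of_etaKatoClaimFrame_of_offLocus` — the crux BY NAME from `hFW` and the
  off-locus stub ALONE (the skeleton's `_of` composed): modulo the claim-frame, item 19601 IS
  `Sig.stub_etaLower_offLocus` («19601 closes with (offLocus) only»).

HONEST FRAMING (cell `bsd-potss`, run/shared/lean/pub/bsd-potss/; FULL-BSD rank ≤ 1 programme, HUMAN
RULING D-0036/D-0074/D-0088): TOOL THEOREMS ONLY — no definition, no named fact minted here, no
`sorry`, axioms standard. §1 is unconditional module theory over a displayed per-pair frame; §2–§3 are
CONDITIONAL on the displayed ∀-frame `hFW`, which transcribes an UNREFEREED preprint read through a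
flagged identification (refereed status: none); nothing is asserted about any curve; the stub is
settled for NO row unconditionally; the crux 19601, its parent 19242 and the route are NOT closed;
nothing is booked; `BSD(W, p)` is claimed for no pair; this is not "finishing BSD". Seat
`bsd-potss-k8-fw` (prover), g0; `--supports stmt-BirchSwinnertonDyer-19601` (helper); the item owner
(k8eta-c1) assembles.

References: [FouquetWan2021] Thm. 5.1 (p. 53), Prop. 5.6 (p. 54), Conj. 1.5 (p. 4) (claim; hypothesis
only); [Kobayashi2003] §4 (p. 8), §5 (p. 10), Thm. 6.2/6.3 (p. 11), Prop. 7.1 ii) (p. 12), Cor. 7.2,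
(7.21), Thm. 7.4 (p. 13), Thm. 3.2 (p. 7); [Kato2004Asterisque] Conj. 12.10 (p. 224), Thm. 12.5 (p. 222);
[Rohrlich1984] (non-vanishing of twists); [Serre1972] §1.11 Prop. 12; [NeukirchSchmidtWingberg2008]
Ch. V §3 (characteristic ideals).
-/

set_option autoImplicit false
-- single-problem summit: the namespace `Summit.BirchSwinnertonDyer.BirchSwinnertonDyer.Theorems` repeats a
-- component by design (D-0017 layout), which `linter.dupNamespace` would flag on every declaration
set_option linter.dupNamespace false

noncomputable section

open scoped Classical

open CongruenceSubgroup Field WeierstrassCurve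
open Literature.NumberTheory.EllipticCurves
open Literature.NumberTheory.EllipticCurves.ModularForms
open Literature.NumberTheory.GaloisRepresentations
open Literature.NumberTheory.EllipticCurves.Rank1Residual
open Summit.BirchSwinnertonDyer.Rank1Residual.Additive hiding EtaSignedSelmerDualData
  IsQuadraticBranchPlusLFunction IsQuadraticBranchMinusLFunction
open Summit.BirchSwinnertonDyer.BirchSwinnertonDyer.Theses.QuadraticBranchSignedControl
open Summit.BirchSwinnertonDyer.BirchSwinnertonDyer.Theorems.Thm74Skeleton

namespace Summit.BirchSwinnertonDyer.BirchSwinnertonDyer.Theorems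

/-! ## §1 The `η`-projection: Kato's main conjecture at `η` (Kobayashi's currency) ⟹ (C1⁺_η) ⟹ (E⁺_η) -/

section Projection

variable {V : WeierstrassCurve ℚ} [V.IsElliptic] [V.IsGloballyMinimal] {p : ℕ} [Fact p.Prime]

/-- **The `η`-PROJECTION (kernel-checked): Kato's main conjecture for `T_pV` at the component `η`, in
the currency of the proof of Kobayashi's Thm. 7.4, implies Kobayashi's EVEN main conjecture at `η`
(C1⁺_η) `QuadraticBranchPlusEtaMainConjectureAt V p`.** Displayed hypothesis `hK` (one pair `(V, p)`):
for every quadratic `η` of `Gal(ℚ(μ_p)/ℚ)`, newform `f` of `V`, period ratio `ϖ`, cyclotomic `κ` and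
generator `γ` matching the variable, there are `Λ`-modules `A` («`𝐇¹(T)^η/Z(T)^η`»), `B`
(«`𝐇²(T)^η ≅ X⁰(V/K_∞)^η`», f.g. torsion), SOME `Lp` with the interpolation property of
`L_p⁺(V, η, X)` and, for every dual datum `D` of `Sel⁺(V/K_∞)^η`, an exact
`0 → A → Λ/(Lp) → D.X → B → 0`, with `char(A) = char(B)`. Proof, per datum: `Lp ≠ 0` (Rohrlich,
`IsQuadraticBranchPlusLFunction.ne_zero_of_isNewformOf`, `ϖ ≠ 0` since `Ω^±_f > 0`); `D.X` is finitely
generated (`Module.Finite.of_exact`) and torsion (`isTorsion_of_exact`, `Λ/(Lp)` torsion);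
`Char(D.X) = (Lp)` iff `char(A) = char(B)` (`charIdeal_eq_span_singleton_iff_of_fourTermExact`); and
`(Lp) = (Lη)` for every other solution `Lη` of the interpolation property (`….span_singleton_eq`).
"The theorem follows from these sequences" (Kobayashi p. 13), direction Kato ⟹ even, at `η`.
CONDITIONAL on `hK` only. [cite: Kobayashi2003, proof of Thm. 7.4 (p. 13), §5 (p. 10), §4 (p. 8), Cor. 7.2]
[cite: NeukirchSchmidtWingberg2008, Ch. V §3] -/
theorem plusEtaMainConjectureAt_of_etaKatoFrame
    (hK : ∀ (K₀ : Type) [Field K₀] [NumberField K₀] [IsCyclotomicExtension {p} ℚ K₀]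
        [(galRange (K := ℚ) K₀).Normal] (ηq : absoluteGaloisGroup ℚ →* ℤˣ),
        (∀ σ ∈ galRange (K := ℚ) K₀, ηq σ = 1) → ηq ≠ 1 →
      ∀ {N : ℕ} [NeZero N] {f : CuspForm (Gamma0 N) 2}, IsNewformOf V f →
      ∀ (ϖ : ℚ), (if Even (p / 2) then (ϖ : ℝ) * V.realPeriodRat = plusPeriod f
          else (ϖ : ℝ) * V.imaginaryPeriodRat = minusPeriod f) →
      ∀ (κ : ZpExtension ℚ p) (γ : absoluteGaloisGroup ℚ),
        κ.IsCyclotomic → κ.IsTopGenerator γ → γ ∈ galRange (K := ℚ) K₀ → IsCyclotomicVariable p γ →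
      ∃ (A B : Type) (_ : AddCommGroup A) (_ : Module (IwasawaAlgebra p) A)
        (_ : AddCommGroup B) (_ : Module (IwasawaAlgebra p) B),
        Module.Finite (IwasawaAlgebra p) B ∧ Module.IsTorsion (IwasawaAlgebra p) B ∧
        (∃ Lp : IwasawaAlgebra p, Kobayashi2003.IsQuadraticBranchPlusLFunction f p ϖ Lp ∧
          ∀ D : Kobayashi2003.EtaSignedSelmerDualData V κ K₀ ℚ_[p] ηq γ 1,
            ∃ (i : A →ₗ[IwasawaAlgebra p] (IwasawaAlgebra p ⧸ Ideal.span {Lp}))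
              (j : (IwasawaAlgebra p ⧸ Ideal.span {Lp}) →ₗ[IwasawaAlgebra p] D.X)
              (k : D.X →ₗ[IwasawaAlgebra p] B),
              Function.Injective i ∧ Function.Exact i j ∧ Function.Exact j k ∧
                Function.Surjective k) ∧
        Module.charIdeal (IwasawaAlgebra p) A = Module.charIdeal (IwasawaAlgebra p) B)
    (hp2 : p ≠ 2) (hgood : V.HasGoodReductionAtPrime p) :
    QuadraticBranchPlusEtaMainConjectureAt V p := by
  intro K₀ _ _ _ _ ηq hηK hη1 N _ f _ _ hap hf ϖ hϖ Lη hLη κ γ hκ hγ hγK hγc D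
  obtain ⟨A, B, _, _, _, _, hBfg, hBtors, ⟨Lp, hLp, hseq⟩, hAB⟩ :=
    hK K₀ ηq hηK hη1 hf ϖ hϖ κ γ hκ hγ hγK hγc
  -- the period ratio is non-zero (`Ω^±_f > 0`), hence `Lp ≠ 0` (Rohrlich)
  have hϖ0 : ϖ ≠ 0 := by
    rintro rfl
    rw [Rat.cast_zero, zero_mul, zero_mul] at hϖ
    by_cases h : Even (p / 2)
    · rw [if_pos h] at hϖ
      exact (IsNewform0.plusPeriod_pos_holds hf.1 hf.coeffField_eq_bot).ne hϖ
    · rw [if_neg h] at hϖ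
      exact (IsNewform0.minusPeriod_pos_holds hf.1 hf.coeffField_eq_bot).ne hϖ
  have hLp0 : Lp ≠ 0 :=
    Summit.BirchSwinnertonDyer.Rank1Residual.Additive.IsQuadraticBranchPlusLFunction.ne_zero_of_isNewformOf
      hp2 hf hgood hϖ0 hLp
  -- Kobayashi's plus `η`-sequence for the (Literature promotion copy of the) datum `D`
  obtain ⟨i, j, k, hi, hij, hjk, hk⟩ := hseq D.toLiterature
  have hM : Module.IsTorsion (IwasawaAlgebra p) (IwasawaAlgebra p ⧸ Ideal.span {Lp}) :=
    isTorsion_quotient_span_singleton hLp0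
  have hfin : Module.Finite (IwasawaAlgebra p) D.toLiterature.X := Module.Finite.of_exact hjk hk
  have htor : Module.IsTorsion (IwasawaAlgebra p) D.toLiterature.X :=
    isTorsion_of_exact hM hBtors j k hjk
  have hchar : Module.charIdeal (IwasawaAlgebra p) D.toLiterature.X = Ideal.span {Lp} :=
    (charIdeal_eq_span_singleton_iff_of_fourTermExact hBtors hLp0 i j k hi hij hjk hk).mpr hAB
  have hspan : Ideal.span ({Lp} : Set (IwasawaAlgebra p)) = Ideal.span {Lη} :=
    Summit.BirchSwinnertonDyer.Rank1Residual.Additive.IsQuadraticBranchPlusLFunction.span_singleton_eq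
      hp2 hLp hLη
  refine ⟨hfin, htor, ?_⟩
  rw [← EtaSignedSelmerDualData.charIdeal_toLiterature, ← hspan]
  exact hchar

/-- **Hence the Eisenstein inclusion (E⁺_η) `QuadraticBranchPlusEtaLowerInclusionAt V p`** — the
statement the crux 19601 makes per twist — from the same displayed frame `hK` (the lower half of
(C1⁺_η), `quadraticBranchPlusEtaLowerInclusionAt_of_plusEtaMainConjectureAt`). The one-sided form
of the projection (`char(B) ⊆ char(A)` ⟹ `Char(X) ⊆ (Lp)`) is `charIdeal_le_span_singleton_of_fourTermExact`
(same skeleton file); the claim-frame gives equality, so the two-sided road is used. CONDITIONAL on `hK`.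
[cite: Kobayashi2003, proof of Thm. 7.4 (p. 13), §4 (p. 8)] -/
theorem plusEtaLowerInclusionAt_of_etaKatoFrame
    (hK : ∀ (K₀ : Type) [Field K₀] [NumberField K₀] [IsCyclotomicExtension {p} ℚ K₀]
        [(galRange (K := ℚ) K₀).Normal] (ηq : absoluteGaloisGroup ℚ →* ℤˣ),
        (∀ σ ∈ galRange (K := ℚ) K₀, ηq σ = 1) → ηq ≠ 1 →
      ∀ {N : ℕ} [NeZero N] {f : CuspForm (Gamma0 N) 2}, IsNewformOf V f →
      ∀ (ϖ : ℚ), (if Even (p / 2) then (ϖ : ℝ) * V.realPeriodRat = plusPeriod f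
          else (ϖ : ℝ) * V.imaginaryPeriodRat = minusPeriod f) →
      ∀ (κ : ZpExtension ℚ p) (γ : absoluteGaloisGroup ℚ),
        κ.IsCyclotomic → κ.IsTopGenerator γ → γ ∈ galRange (K := ℚ) K₀ → IsCyclotomicVariable p γ →
      ∃ (A B : Type) (_ : AddCommGroup A) (_ : Module (IwasawaAlgebra p) A)
        (_ : AddCommGroup B) (_ : Module (IwasawaAlgebra p) B),
        Module.Finite (IwasawaAlgebra p) B ∧ Module.IsTorsion (IwasawaAlgebra p) B ∧
        (∃ Lp : IwasawaAlgebra p, Kobayashi2003.IsQuadraticBranchPlusLFunction f p ϖ Lp ∧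
          ∀ D : Kobayashi2003.EtaSignedSelmerDualData V κ K₀ ℚ_[p] ηq γ 1,
            ∃ (i : A →ₗ[IwasawaAlgebra p] (IwasawaAlgebra p ⧸ Ideal.span {Lp}))
              (j : (IwasawaAlgebra p ⧸ Ideal.span {Lp}) →ₗ[IwasawaAlgebra p] D.X)
              (k : D.X →ₗ[IwasawaAlgebra p] B),
              Function.Injective i ∧ Function.Exact i j ∧ Function.Exact j k ∧
                Function.Surjective k) ∧
        Module.charIdeal (IwasawaAlgebra p) A = Module.charIdeal (IwasawaAlgebra p) B)
    (hp2 : p ≠ 2) (hgood : V.HasGoodReductionAtPrime p) :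
    QuadraticBranchPlusEtaLowerInclusionAt V p :=
  quadraticBranchPlusEtaLowerInclusionAt_of_plusEtaMainConjectureAt
    (plusEtaMainConjectureAt_of_etaKatoFrame hK hp2 hgood)

end Projection

/-! ## §2 The ∀-frame (body of `FouquetWan2021.thm51_etaKatoMC_OPEN`) on its locus, and
the registered stub `Sig.stub_etaLower_fwLocus` VERBATIM from it -/

section ClaimFrame

variable
  (hFW : ∀ (p : ℕ) [Fact p.Prime] (K₀ : Type) [Field K₀] [NumberField K₀]
      [IsCyclotomicExtension {p} ℚ K₀] [(galRange (K := ℚ) K₀).Normal]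
      (η : absoluteGaloisGroup ℚ →* ℤˣ), (∀ σ ∈ galRange (K := ℚ) K₀, η σ = 1) → η ≠ 1 →
    ∀ (V : WeierstrassCurve ℚ) [V.IsElliptic] [V.IsGloballyMinimal]
      (W : WeierstrassCurve ℚ) [W.IsElliptic] [W.IsGloballyMinimal] (C : VariableChange ℚ),
      p ≠ 2 → C • W.quadraticTwist ((-1) ^ (p / 2) * p) = V →
      V.HasGoodReductionAtPrime p → V.frobeniusTrace p = 0 → Irr W p →
      (∃ (ℓ : ℕ) (_ : Fact ℓ.Prime), ℓ ≠ p ∧ W.HasMultiplicativeReductionAtPrime ℓ ∧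
          ¬ W.HasSplitMultiplicativeReductionAtPrime ℓ ∧
          ¬ p ∣ padicValInt ℓ W.minimalDiscriminantInt) →
    ∀ {N : ℕ} [NeZero N] {f : CuspForm (Gamma0 N) 2}, IsNewformOf V f →
    ∀ (ϖ : ℚ), (if Even (p / 2) then (ϖ : ℝ) * V.realPeriodRat = plusPeriod f
        else (ϖ : ℝ) * V.imaginaryPeriodRat = minusPeriod f) →
    ∀ (κ : ZpExtension ℚ p) (γ : absoluteGaloisGroup ℚ),
      κ.IsCyclotomic → κ.IsTopGenerator γ → γ ∈ galRange (K := ℚ) K₀ → IsCyclotomicVariable p γ →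
    ∃ (A B : Type) (_ : AddCommGroup A) (_ : Module (IwasawaAlgebra p) A)
      (_ : AddCommGroup B) (_ : Module (IwasawaAlgebra p) B),
      Module.Finite (IwasawaAlgebra p) B ∧ Module.IsTorsion (IwasawaAlgebra p) B ∧
      (∃ Lp : IwasawaAlgebra p, Kobayashi2003.IsQuadraticBranchPlusLFunction f p ϖ Lp ∧
        ∀ D : Kobayashi2003.EtaSignedSelmerDualData V κ K₀ ℚ_[p] η γ 1,
          ∃ (i : A →ₗ[IwasawaAlgebra p] (IwasawaAlgebra p ⧸ Ideal.span {Lp}))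
            (j : (IwasawaAlgebra p ⧸ Ideal.span {Lp}) →ₗ[IwasawaAlgebra p] D.X)
            (k : D.X →ₗ[IwasawaAlgebra p] B),
            Function.Injective i ∧ Function.Exact i j ∧ Function.Exact j k ∧
              Function.Surjective k) ∧
      Module.charIdeal (IwasawaAlgebra p) A = Module.charIdeal (IwasawaAlgebra p) B)

include hFW

/-- **(C1⁺_η) — Kobayashi's even main conjecture at `η`, VERBATIM on `X⁺(V/K_∞)^η` — on the
Fouquet–Wan locus of the additive partner, from the displayed ∀-frame `hFW`** (binder for binder the
body of the OPEN binder `FouquetWan2021.thm51_etaKatoMC_OPEN`: Fouquet–Wan Thm. 5.1 /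
Prop. 5.6 for `f_W = f_V ⊗ η` — an UNREFEREED CLAIM — read at the `η`-component of `T_pV`, flag
`FW21-eta-twist-transfer`): for `p` odd, `W/ℚ` globally minimal with `W[p]` irreducible (`Irr W p`) and
a non-split multiplicative prime `ℓ ≠ p` with `p ∤ ord_ℓ(Δ_min(W))` (Thm. 5.1's third bullet), and `V`
a globally minimal model of `W^{(p*)}` GOOD at `p` with `a_p(V) = 0`: `QuadraticBranchPlusEtaMainConjectureAt V p`.
§1's projection applied to `hFW` at `(V, W, C)`. CONDITIONAL on `hFW`; closes nothing.
[cite: FouquetWan2021, Thm. 5.1 (p. 53) and Prop. 5.6 (p. 54) (claim; hypothesis only)]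
[cite: Kobayashi2003, §5 (p. 10), proof of Thm. 7.4 (p. 13), §4 (p. 8)] -/
theorem plusEtaMainConjectureAt_of_etaKatoClaimFrame
    (W : WeierstrassCurve ℚ) [W.IsElliptic] [W.IsGloballyMinimal]
    (V : WeierstrassCurve ℚ) [V.IsElliptic] [V.IsGloballyMinimal] (C : VariableChange ℚ)
    (p : ℕ) [Fact p.Prime] (hp2 : p ≠ 2) (hWV : C • W.quadraticTwist ((-1) ^ (p / 2) * p) = V)
    (hgood : V.HasGoodReductionAtPrime p) (hap : V.frobeniusTrace p = 0) (hirr : Irr W p)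
    (hR : ∃ (ℓ : ℕ) (_ : Fact ℓ.Prime), ℓ ≠ p ∧ W.HasMultiplicativeReductionAtPrime ℓ ∧
      ¬ W.HasSplitMultiplicativeReductionAtPrime ℓ ∧ ¬ p ∣ padicValInt ℓ W.minimalDiscriminantInt) :
    QuadraticBranchPlusEtaMainConjectureAt V p :=
  plusEtaMainConjectureAt_of_etaKatoFrame
    (fun K₀ _ _ _ _ ηq hηK hη1 _ _ _ hf ϖ hϖ κ γ hκ hγ hγK hγc =>
      hFW p K₀ ηq hηK hη1 V W C hp2 hWV hgood hap hirr hR hf ϖ hϖ κ γ hκ hγ hγK hγc)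
    hp2 hgood

/-- **(E⁺_η) on the Fouquet–Wan locus of the additive partner, from `hFW`** (lower half of the
previous theorem). CONDITIONAL on `hFW`; closes nothing.
[cite: FouquetWan2021, Thm. 5.1 (p. 53) (claim; hypothesis only)] [cite: Kobayashi2003, §4 (p. 8), Thm. 7.4 (p. 13)] -/
theorem plusEtaLowerInclusionAt_of_etaKatoClaimFrame
    (W : WeierstrassCurve ℚ) [W.IsElliptic] [W.IsGloballyMinimal]
    (V : WeierstrassCurve ℚ) [V.IsElliptic] [V.IsGloballyMinimal] (C : VariableChange ℚ)
    (p : ℕ) [Fact p.Prime] (hp2 : p ≠ 2) (hWV : C • W.quadraticTwist ((-1) ^ (p / 2) * p) = V)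
    (hgood : V.HasGoodReductionAtPrime p) (hap : V.frobeniusTrace p = 0) (hirr : Irr W p)
    (hR : ∃ (ℓ : ℕ) (_ : Fact ℓ.Prime), ℓ ≠ p ∧ W.HasMultiplicativeReductionAtPrime ℓ ∧
      ¬ W.HasSplitMultiplicativeReductionAtPrime ℓ ∧ ¬ p ∣ padicValInt ℓ W.minimalDiscriminantInt) :
    QuadraticBranchPlusEtaLowerInclusionAt V p :=
  quadraticBranchPlusEtaLowerInclusionAt_of_plusEtaMainConjectureAt
    (plusEtaMainConjectureAt_of_etaKatoClaimFrame hFW W V C p hp2 hWV hgood hap hirr hR)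

/-- **`Sig.stub_etaLower_fwLocus` (registered stub of crux 19601, VERBATIM — the planner's
abbreviation `FWLocus V p` unfolded to its `∃`-datum) from the displayed ∀-frame `hFW`.** For every
good `a_p = 0` twist `V`, `p ≥ 5`, whose `p`-adic tower is onto and which lies in the Fouquet–Wan
sub-locus (a Gss2 partner `W` — `Addv W p ∧ SubGss W p` — with `FWNonsplitRam W p ∧
Kato2004.ImageContainsSL2 W p`), the Eisenstein inclusion (E⁺_η) `QuadraticBranchPlusEtaLowerInclusionAt V p`
holds: `W[p]` is irreducible on Gss2 (`irr_of_subGss_of_ne_two`: the twist `V` is good supersingular,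
Serre 1972 Prop. 12, and irreducibility descends), `FWNonsplitRam W p` IS Thm. 5.1's `ℓ`-datum, then
`plusEtaLowerInclusionAt_of_etaKatoClaimFrame`; the tower and `SL₂` binders are unused. So the stub is
CONDITIONAL on exactly ONE unpublished input — the claim-frame `hFW` = the OPEN binder
`FouquetWan2021.thm51_etaKatoMC_OPEN` (PRE; reading flag `FW21-eta-twist-transfer`) —
everything else being kernel-checked or PROVED in the tree. Closes nothing (19601 needs the off-locus
stub; the sub-locus rows are CLAIMED, not refereed). [cite: Serre1972, §1.11 Prop. 12]
[cite: FouquetWan2021, Thm. 5.1 (p. 53) and Prop. 5.6 (p. 54) (claim; hypothesis only)]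
[cite: Kobayashi2003, §4 (p. 8), §5 (p. 10), Thm. 7.4 (p. 13)] -/
theorem stub_etaLower_fwLocus_of_etaKatoClaimFrame :
    ∀ (V : WeierstrassCurve ℚ) [V.IsElliptic] [V.IsGloballyMinimal] (p : ℕ) [Fact p.Prime],
      5 ≤ p → V.HasGoodReductionAtPrime p → V.frobeniusTrace p = 0 →
      (∀ m : ℕ, V.HasSurjectiveModNGaloisRep (p ^ m : ℕ)) →
      (∃ (W : WeierstrassCurve ℚ) (_ : W.IsElliptic) (_ : W.IsGloballyMinimal) (C : VariableChange ℚ),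
        C • W.quadraticTwist ((-1) ^ (p / 2) * p) = V ∧ Addv W p ∧ SubGss W p ∧
          FWNonsplitRam W p ∧ Kato2004.ImageContainsSL2 W p) →
      QuadraticBranchPlusEtaLowerInclusionAt V p := by
  intro V _ _ p _ hp5 hgood hap _ hL
  obtain ⟨W, _, _, C, hWV, hadd, hG, hR, _⟩ := hL
  have hp2 : p ≠ 2 := by omega
  exact plusEtaLowerInclusionAt_of_etaKatoClaimFrame hFW W V C p hp2 hWV hgood hap
    (irr_of_subGss_of_ne_two W p hp2 hadd hG) hR

/-! ## §3 Modulo the claim-frame, the crux IS its off-locus stub -/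

/-- **The crux `PlusEtaLowerInclusion` (item 19601) BY NAME from the displayed ∀-frame `hFW` and the
off-locus stub `Sig.stub_etaLower_offLocus` (VERBATIM, displayed as `hoff`) ALONE** — the skeleton's
composition `PlusEtaLowerInclusion_of` with its first leg discharged by
`stub_etaLower_fwLocus_of_etaKatoClaimFrame` (`by_cases` on the locus): modulo the Fouquet–Wan
claim-frame the item IS the Eisenstein inclusion at `η` on the tower-onto twists with NO Gss2 partner
carrying a ramified non-split Steinberg prime and `SL₂`-image — where nothing is in print.
CONDITIONAL on `hFW` and `hoff`; closes nothing; the item owner assembles.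
[cite: FouquetWan2021, Thm. 5.1 (p. 53) (claim; hypothesis only)] [cite: Kobayashi2003, §4 (p. 8)] -/
theorem plusEtaLowerInclusion_of_etaKatoClaimFrame_of_offLocus
    (hoff : ∀ (V : WeierstrassCurve ℚ) [V.IsElliptic] [V.IsGloballyMinimal] (p : ℕ) [Fact p.Prime],
      5 ≤ p → V.HasGoodReductionAtPrime p → V.frobeniusTrace p = 0 →
      (∀ m : ℕ, V.HasSurjectiveModNGaloisRep (p ^ m : ℕ)) →
      ¬ (∃ (W : WeierstrassCurve ℚ) (_ : W.IsElliptic) (_ : W.IsGloballyMinimal) (C : VariableChange ℚ),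
        C • W.quadraticTwist ((-1) ^ (p / 2) * p) = V ∧ Addv W p ∧ SubGss W p ∧
          FWNonsplitRam W p ∧ Kato2004.ImageContainsSL2 W p) →
      QuadraticBranchPlusEtaLowerInclusionAt V p) :
    PlusEtaLowerInclusion := by
  intro V _ _ p _ h5 hg ha hs
  by_cases hL : ∃ (W : WeierstrassCurve ℚ) (_ : W.IsElliptic) (_ : W.IsGloballyMinimal)
      (C : VariableChange ℚ), C • W.quadraticTwist ((-1) ^ (p / 2) * p) = V ∧ Addv W p ∧ SubGss W p ∧
        FWNonsplitRam W p ∧ Kato2004.ImageContainsSL2 W p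
  · exact stub_etaLower_fwLocus_of_etaKatoClaimFrame hFW V p h5 hg ha hs hL
  · exact hoff V p h5 hg ha hs hL

end ClaimFrame

end Summit.BirchSwinnertonDyer.BirchSwinnertonDyer.Theorems

end
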